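import Literature.Computability.Complexity.SmallBiasXor
import HarnessLib

/-!
# Cell qa-qnc0 (rung F-Q1, fence F9-V): distributions on the Boolean cube — characters, product measures,
# XOR-convolution, Fourier inversion, and the law of an odd XOR-fold of a noisy coset

Toolkit over the elementary vocabulary of `Literature/Computability/Complexity/SmallBiasXor.lean`
(`Distr`, `IsDistr`, `unifDistr`, `parityBias`, `xorConv`, `xorFold`, `polyBias`; Viola 2009), for the
kernel form of FENCE F9-V (`ViolaFence`, planner qa-qnc0-p2 ROUND-9/10, ask P-10V; `ViolaFence.lean`):

* characters `chi a w = (−1)^{⟨a,w⟩}` as products, multiplicativity under XOR, the character sums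
  `Σ_a chi a u = 2^N·[u = 0]` and **Fourier inversion** (`eq_of_parityBias_eq`: a weight function is
  determined by its parity biases);
* the PRODUCT LEMMA `sum_prod_bool` and the product Bernoulli measure `ber N p`: a distribution with biases
  `(1 − 2p)^{|a|}` (`parityBias_ber`, Sketch10 `L2`) and the exponential-moment tail
  `Σ_{|w| ≥ k} ber ≤ (1+p)^N / 2^k` (`ber_tail_le`);
* XOR-convolution: a distribution (`isDistr_xorConv`), **biases multiply** (`parityBias_xorConv`, Sketch10
  `L1`), `xorFold` of `d` copies has biases `bias^d`;
* uniform measure on a finite set (`unifOn`): on a nonempty TRIPLE-SUM-CLOSED set (a coset of a linear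
  code) every parity bias is `0`, `1` or `−1` (`parityBias_unifOn_trichotomy`), hence the **fold law**
  (`foldLaw`, Sketch10 `L4`): the XOR of an odd number `d` of samples of `unifOn S ⊕ Ber(p)` has law
  `unifOn S ⊕ Ber((1 − (1−2p)^d)/2)`.

All [folklore]; no named facts.  WHAT THIS IS NOT: nothing on α; separation NOT moved.
-/

noncomputable section

namespace Summit.QuantumAdvantage.AdviceFreeQNC0

namespace CubeDistr

open Finset
open Literature.Computability.Complexity.SmallBiasXor

variable {N : ℕ}

/-! ### Characters -/

/-- The sign `(−1)^{[b]}`. -/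
def sgn (b : Bool) : ℝ := if b = true then -1 else 1

/-- The character `χ_a(w) = (−1)^{#{i : a_i ∧ w_i}}` (the sign inside `parityBias`). -/
def chi (a w : Fin N → Bool) : ℝ := if (univ.filter fun i => a i && w i).card % 2 = 0 then 1 else -1

/-- `parityBias` through `chi`. -/
theorem parityBias_eq (μ : Distr N) (a : Fin N → Bool) : parityBias μ a = ∑ w, μ w * chi a w := rfl

/-- A character is a product of signs. -/
theorem chi_eq_prod (a w : Fin N → Bool) : chi a w = ∏ i, sgn (a i && w i) := by
  unfold chi sgn
  rw [Finset.prod_ite, Finset.prod_const_one, mul_one, Finset.prod_const]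
  rcases Nat.even_or_odd ((univ.filter fun i => (a i && w i) = true).card) with h | h
  · rw [if_pos (Nat.even_iff.1 h), h.neg_one_pow]
  · rw [if_neg (by rw [Nat.odd_iff.1 h]; norm_num), h.neg_one_pow]

/-- `χ_a(w) ∈ {1, −1}`. -/
theorem chi_sq (a w : Fin N → Bool) : chi a w * chi a w = 1 := by
  unfold chi; split_ifs <;> norm_num

/-- `|χ_a(w)| = 1`. -/
theorem abs_chi (a w : Fin N → Bool) : |chi a w| = 1 := by
  unfold chi; split_ifs <;> norm_num

/-- Characters are symmetric in the two arguments. -/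
theorem chi_symm (a w : Fin N → Bool) : chi a w = chi w a := by
  rw [chi_eq_prod, chi_eq_prod]
  exact Finset.prod_congr rfl fun i _ => by rw [Bool.and_comm]

/-- Pointwise XOR of two points of the cube. -/
def bxor (v w : Fin N → Bool) : Fin N → Bool := fun i => xor (v i) (w i)

/-- `v ⊕ (v ⊕ w) = w`. -/
theorem bxor_bxor_cancel (v w : Fin N → Bool) : bxor v (bxor v w) = w := by
  funext i; unfold bxor; cases v i <;> cases w i <;> rfl

/-- `v ⊕ w = 0 ↔ v = w`. -/
theorem bxor_eq_zero_iff (v w : Fin N → Bool) : bxor v w = (fun _ => false) ↔ v = w := by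
  constructor
  · intro h; funext i
    have := congrFun h i
    unfold bxor at this
    revert this; cases v i <;> cases w i <;> decide
  · rintro rfl; funext i; unfold bxor; cases v i <;> rfl

/-- **Multiplicativity**: `χ_a(v ⊕ w) = χ_a(v)·χ_a(w)`. -/
theorem chi_bxor (a v w : Fin N → Bool) : chi a (bxor v w) = chi a v * chi a w := by
  rw [chi_eq_prod, chi_eq_prod, chi_eq_prod, ← Finset.prod_mul_distrib]
  refine Finset.prod_congr rfl fun i _ => ?_
  unfold bxor sgn
  cases a i <;> cases v i <;> cases w i <;> norm_num

/-- Reindexing a sum along the translation `w ↦ v ⊕ w`. -/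
theorem sum_bxor (v : Fin N → Bool) (f : (Fin N → Bool) → ℝ) : ∑ w, f (bxor v w) = ∑ w, f w :=
  Equiv.sum_comp (Function.Involutive.toPerm (bxor v) (bxor_bxor_cancel v)) f

/-! ### The product lemma and character sums -/

/-- **Product lemma**: a product weight sums to the product of the coordinate sums. -/
theorem sum_prod_bool (f : Fin N → Bool → ℝ) : ∑ w : Fin N → Bool, ∏ i, f i (w i) = ∏ i, (f i true + f i false) := by
  classical
  have h := Finset.prod_univ_sum (t := fun _ : Fin N => (univ : Finset Bool)) (f := f)
  rw [Fintype.piFinset_univ] at h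
  rw [← h]
  exact Finset.prod_congr rfl fun i _ => Fintype.sum_bool (f i)

/-- **Character sums**: `Σ_a χ_a(u) = 2^N` if `u = 0`, else `0`. -/
theorem sum_chi (u : Fin N → Bool) : ∑ a, chi a u = if u = (fun _ => false) then (2 : ℝ) ^ N else 0 := by
  have h : ∑ a, chi a u = ∏ i : Fin N, (sgn (true && u i) + sgn (false && u i)) := by
    simp only [chi_eq_prod]
    exact sum_prod_bool (fun i b => sgn (b && u i))
  rw [h]
  by_cases hu : u = fun _ => false
  · rw [if_pos hu, hu]
    simp only [Bool.and_false, sgn, Bool.false_eq_true, if_false]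
    rw [Finset.prod_const, Finset.card_univ, Fintype.card_fin]; norm_num
  · rw [if_neg hu]
    obtain ⟨i, hi⟩ : ∃ i, u i = true := by
      by_contra h'
      push Not at h'
      exact hu (funext fun i => by simpa using h' i)
    refine Finset.prod_eq_zero (Finset.mem_univ i) ?_
    rw [hi]; simp [sgn]

/-- **Fourier inversion**: `Σ_a bias_μ(a)·χ_a(w) = 2^N·μ(w)`. -/
theorem sum_parityBias_mul_chi (μ : Distr N) (w : Fin N → Bool) :
    ∑ a, parityBias μ a * chi a w = (2 : ℝ) ^ N * μ w := by
  simp only [parityBias_eq, Finset.sum_mul]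
  rw [Finset.sum_comm]
  have h : ∀ v, ∑ a, μ v * chi a v * chi a w = μ v * (if bxor v w = (fun _ => false) then (2 : ℝ) ^ N else 0) := by
    intro v
    rw [← sum_chi (bxor v w), Finset.mul_sum]
    exact Finset.sum_congr rfl fun a _ => by rw [chi_bxor]; ring
  rw [Finset.sum_congr rfl fun v _ => h v]
  simp only [bxor_eq_zero_iff, mul_ite, mul_zero, Finset.sum_ite_eq', Finset.mem_univ, if_true]
  ring

/-- A weight function is determined by its parity biases. -/
theorem eq_of_parityBias_eq (μ ν : Distr N) (h : ∀ a, parityBias μ a = parityBias ν a) : μ = ν := by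
  funext w
  have h1 := sum_parityBias_mul_chi μ w
  have h2 := sum_parityBias_mul_chi ν w
  simp only [h] at h1
  rw [h1] at h2
  have hpos : (0 : ℝ) < (2 : ℝ) ^ N := by positivity
  exact mul_left_cancel₀ hpos.ne' h2

/-! ### Hamming weight and the product Bernoulli measure -/

/-- Hamming weight of a point of the cube. -/
def hw (w : Fin N → Bool) : ℕ := (univ.filter fun i => w i = true).card

/-- `hw w ≤ N`. -/
theorem hw_le (w : Fin N → Bool) : hw w ≤ N :=
  le_trans (Finset.card_le_univ _) (by rw [Fintype.card_fin])

/-- `x^{|w|}·y^{N−|w|}` as a product over the coordinates. -/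
theorem pow_hw_mul_pow (x y : ℝ) (w : Fin N → Bool) :
    x ^ hw w * y ^ (N - hw w) = ∏ i, (if w i = true then x else y) := by
  rw [Finset.prod_ite, Finset.prod_const, Finset.prod_const]
  unfold hw
  congr 2
  have h := Finset.card_filter_add_card_filter_not (s := (univ : Finset (Fin N))) (fun i => w i = true)
  rw [Finset.card_univ, Fintype.card_fin] at h
  omega

/-- The product Bernoulli measure `Ber(p)^N`. -/
def ber (N : ℕ) (p : ℝ) : Distr N := fun w => p ^ hw w * (1 - p) ^ (N - hw w)

/-- `ber` as a product. -/
theorem ber_eq_prod (p : ℝ) (w : Fin N → Bool) : ber N p w = ∏ i, (if w i = true then p else 1 - p) :=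
  pow_hw_mul_pow p (1 - p) w

/-- Total mass `1`. -/
theorem sum_ber (p : ℝ) : ∑ w, ber N p w = 1 := by
  simp only [ber_eq_prod]
  rw [sum_prod_bool (fun _ b => if b = true then p else 1 - p)]
  simp

/-- `ber` is a distribution for `p ∈ [0,1]`. -/
theorem isDistr_ber {p : ℝ} (hp0 : 0 ≤ p) (hp1 : p ≤ 1) : IsDistr (ber N p) :=
  ⟨fun w => mul_nonneg (pow_nonneg hp0 _) (pow_nonneg (by linarith) _), sum_ber p⟩

/-- **Biases of the Bernoulli measure**: `(1 − 2p)^{|a|}` (Sketch10 `L2`). -/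
theorem parityBias_ber (p : ℝ) (a : Fin N → Bool) : parityBias (ber N p) a = (1 - 2 * p) ^ hw a := by
  rw [parityBias_eq]
  have h : ∀ w, ber N p w * chi a w = ∏ i, ((if w i = true then p else 1 - p) * sgn (a i && w i)) := by
    intro w; rw [ber_eq_prod, chi_eq_prod, Finset.prod_mul_distrib]
  simp only [h]
  rw [sum_prod_bool (fun i b => (if b = true then p else 1 - p) * sgn (a i && b))]
  rw [show (1 - 2 * p) ^ hw a = ∏ i : Fin N, (if a i = true then 1 - 2 * p else 1) by
    rw [Finset.prod_ite, Finset.prod_const, Finset.prod_const_one, mul_one]; rfl]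
  refine Finset.prod_congr rfl fun i _ => ?_
  cases a i <;> simp [sgn]
  all_goals ring

/-- **Exponential-moment tail of the Bernoulli weight** (`p ≥ 0`): `Σ_{|w| ≥ k} Ber(p)(w) ≤ (1+p)^N / 2^k`
(Markov on `2^{|w|}`, whose mean is `(1 − p + 2p)^N`). -/
theorem ber_tail_le {p : ℝ} (hp0 : 0 ≤ p) (hp1 : p ≤ 1) (k : ℕ) :
    (∑ w : Fin N → Bool, (if k ≤ hw w then ber N p w else 0)) ≤ (1 + p) ^ N / (2 : ℝ) ^ k := by
  have hmean : ∑ w : Fin N → Bool, ber N p w * (2 : ℝ) ^ hw w = (1 + p) ^ N := by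
    have h : ∀ w : Fin N → Bool, ber N p w * (2 : ℝ) ^ hw w =
        ∏ i, (if w i = true then 2 * p else 1 - p) := by
      intro w
      rw [ber_eq_prod]
      have h1 : (2 : ℝ) ^ hw w = ∏ i : Fin N, (if w i = true then (2 : ℝ) else 1) := by
        rw [Finset.prod_ite, Finset.prod_const, Finset.prod_const_one, mul_one]; rfl
      rw [h1, ← Finset.prod_mul_distrib]
      exact Finset.prod_congr rfl fun i _ => by split_ifs <;> ring
    simp only [h]
    rw [sum_prod_bool (fun _ b => if b = true then 2 * p else 1 - p)]
    simp only [if_true, Bool.false_eq_true, if_false, Finset.prod_const, Finset.card_univ, Fintype.card_fin]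
    ring
  have h2k : (0 : ℝ) < (2 : ℝ) ^ k := by positivity
  rw [le_div_iff₀ h2k, ← hmean, Finset.sum_mul]
  refine Finset.sum_le_sum fun w _ => ?_
  have hb : 0 ≤ ber N p w := (isDistr_ber hp0 hp1).1 w
  split_ifs with h
  · exact mul_le_mul_of_nonneg_left (pow_le_pow_right₀ (by norm_num) h) hb
  · rw [zero_mul]; positivity

/-! ### XOR-convolution -/

/-- Unfolding `xorConv`. -/
theorem xorConv_apply (μ ν : Distr N) (w : Fin N → Bool) : xorConv μ ν w = ∑ v, μ v * ν (bxor v w) := rfl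

/-- Total mass of a convolution. -/
theorem sum_xorConv (μ ν : Distr N) (hν : ∑ w, ν w = 1) : ∑ w, xorConv μ ν w = ∑ v, μ v := by
  simp only [xorConv_apply]
  rw [Finset.sum_comm]
  refine Finset.sum_congr rfl fun v _ => ?_
  rw [← Finset.mul_sum, sum_bxor v ν, hν, mul_one]

/-- A convolution of distributions is a distribution (Sketch10 `L2`). -/
theorem isDistr_xorConv {μ ν : Distr N} (hμ : IsDistr μ) (hν : IsDistr ν) : IsDistr (xorConv μ ν) :=
  ⟨fun w => Finset.sum_nonneg fun v _ => mul_nonneg (hμ.1 v) (hν.1 _),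
    by rw [sum_xorConv μ ν hν.2, hμ.2]⟩

/-- **Biases multiply under convolution** (Sketch10 `L1`). -/
theorem parityBias_xorConv (μ ν : Distr N) (a : Fin N → Bool) :
    parityBias (xorConv μ ν) a = parityBias μ a * parityBias ν a := by
  simp only [parityBias_eq, xorConv_apply, Finset.sum_mul]
  rw [Finset.sum_comm]
  refine Finset.sum_congr rfl fun v _ => ?_
  have h : ∀ w, μ v * ν (bxor v w) * chi a w = μ v * chi a v * (ν (bxor v w) * chi a (bxor v w)) := by
    intro w; rw [chi_bxor]
    have := chi_sq a v
    calc μ v * ν (bxor v w) * chi a w = μ v * ν (bxor v w) * chi a w * (chi a v * chi a v) := by rw [this, mul_one]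
      _ = μ v * chi a v * (ν (bxor v w) * (chi a v * chi a w)) := by ring
  rw [Finset.sum_congr rfl fun w _ => h w, ← Finset.mul_sum, sum_bxor v (fun w => ν w * chi a w)]

/-- Biases of an `xorFold` of copies are powers. -/
theorem parityBias_xorFold_replicate (μ : Distr N) (a : Fin N → Bool) :
    ∀ d : ℕ, parityBias (xorFold (List.replicate d μ)) a = parityBias μ a ^ d
  | 0 => by
    rw [pow_zero, List.replicate_zero]
    show parityBias (fun w => if w = (fun _ => false) then 1 else 0) a = 1
    rw [parityBias_eq, Finset.sum_eq_single (fun _ => false)]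
    · rw [if_pos rfl, one_mul]; unfold chi; simp
    · intro w _ hw; rw [if_neg hw, zero_mul]
    · intro h; exact absurd (Finset.mem_univ _) h
  | d + 1 => by
    rw [List.replicate_succ]
    show parityBias (xorConv μ (xorFold (List.replicate d μ))) a = _
    rw [parityBias_xorConv, parityBias_xorFold_replicate μ a d, pow_succ, mul_comm]

/-! ### `polyBias` and the uniform distributions -/

/-- `polyBias μ q = 1 − 2·μ{q}` for a distribution. -/
theorem polyBias_eq (μ : Distr N) (hμ : ∑ w, μ w = 1) (q : (Fin N → Bool) → Bool) :
    polyBias μ q = 1 - 2 * ∑ w, (if q w = true then μ w else 0) := by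
  unfold polyBias
  have h : ∀ w, μ w * (if q w = true then (-1 : ℝ) else 1) = μ w - 2 * (if q w = true then μ w else 0) := by
    intro w; split_ifs <;> ring
  rw [Finset.sum_congr rfl fun w _ => h w, Finset.sum_sub_distrib, hμ, ← Finset.mul_sum]

/-- The uniform distribution is a distribution. -/
theorem isDistr_unifDistr : IsDistr (unifDistr N) := by
  refine ⟨fun w => by unfold unifDistr; positivity, ?_⟩
  unfold unifDistr
  rw [Finset.sum_const, Finset.card_univ, Fintype.card_fun, Fintype.card_fin, Fintype.card_bool,
    nsmul_eq_mul]
  push_cast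
  field_simp

/-- Uniform measure on a finite set of points (zero if the set is empty). -/
def unifOn (S : Finset (Fin N → Bool)) : Distr N := fun w => if w ∈ S then 1 / (S.card : ℝ) else 0

/-- `unifOn S` is a distribution for `S` nonempty. -/
theorem isDistr_unifOn {S : Finset (Fin N → Bool)} (hS : S.Nonempty) : IsDistr (unifOn S) := by
  refine ⟨fun w => by unfold unifOn; split_ifs <;> positivity, ?_⟩
  unfold unifOn
  rw [← Finset.sum_filter]
  have h : (univ.filter fun w => w ∈ S) = S := by ext w; simp
  rw [h, Finset.sum_const, nsmul_eq_mul]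
  have hc : (S.card : ℝ) ≠ 0 := by exact_mod_cast hS.card_pos.ne'
  field_simp

/-- Biases of `unifOn S`: character averages. -/
theorem parityBias_unifOn (S : Finset (Fin N → Bool)) (a : Fin N → Bool) :
    parityBias (unifOn S) a = (∑ s ∈ S, chi a s) / (S.card : ℝ) := by
  rw [parityBias_eq]
  unfold unifOn
  rw [Finset.sum_div, ← Finset.sum_filter_add_sum_filter_not univ (fun w => w ∈ S)]
  have h : (univ.filter fun w => w ∈ S) = S := by ext w; simp
  rw [h, Finset.sum_eq_zero (s := univ.filter fun w => ¬ w ∈ S), add_zero]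
  · exact Finset.sum_congr rfl fun w hw => by rw [if_pos hw]; ring
  · intro w hw; rw [Finset.mem_filter] at hw; rw [if_neg hw.2, zero_mul]

/-! ### Cosets: triple-sum-closed sets -/

/-- `S` is closed under sums of three of its points (a coset of a linear code, if nonempty). -/
def TripleClosed (S : Finset (Fin N → Bool)) : Prop := ∀ x ∈ S, ∀ y ∈ S, ∀ z ∈ S, bxor (bxor x y) z ∈ S

/-- **Coset character sums**: on a nonempty triple-sum-closed set a character is either BALANCED or CONSTANT. -/
theorem coset_chi_dichotomy {S : Finset (Fin N → Bool)} (hT : TripleClosed S) (a : Fin N → Bool) :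
    (∑ s ∈ S, chi a s = 0) ∨ (∀ s ∈ S, ∀ s' ∈ S, chi a s = chi a s') := by
  classical
  by_cases hconst : ∀ s ∈ S, ∀ s' ∈ S, chi a s = chi a s'
  · exact Or.inr hconst
  left
  push Not at hconst
  obtain ⟨s₀, hs₀, s₁, hs₁, hne⟩ := hconst
  -- the translation by `s₀ ⊕ s₁` is a sign-reversing involution of `S`
  have hflip : chi a (bxor s₀ s₁) = -1 := by
    rw [chi_bxor]
    have h0 := chi_sq a s₀
    have h1 := chi_sq a s₁
    have : chi a s₀ = 1 ∨ chi a s₀ = -1 := by unfold chi; split_ifs <;> simp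
    have : chi a s₁ = 1 ∨ chi a s₁ = -1 := by unfold chi; split_ifs <;> simp
    rcases ‹chi a s₀ = 1 ∨ chi a s₀ = -1› with h | h <;> rcases this with h' | h' <;>
      simp_all
  refine Finset.sum_involution (fun s _ => bxor (bxor s₀ s₁) s) ?_ ?_ ?_ ?_
  · intro s hs
    rw [chi_bxor, hflip]; ring
  · intro s hs hne' heq
    have : bxor s₀ s₁ = fun _ => false := by
      have h := congrArg (bxor (bxor s₀ s₁)) heq
      rw [bxor_bxor_cancel] at h
      -- `t ⊕ s = s` forces `t = 0`
      funext i
      have hi := congrFun heq i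
      unfold bxor at hi ⊢
      revert hi; cases s₀ i <;> cases s₁ i <;> cases s i <;> decide
    rw [this] at hflip
    unfold chi at hflip; simp at hflip; norm_num at hflip
  · intro s hs
    have h := hT s₀ hs₀ s₁ hs₁ s hs
    exact h
  · intro s hs
    exact bxor_bxor_cancel _ _

/-- Hence every bias of `unifOn S` is `0`, `1` or `−1`. -/
theorem parityBias_unifOn_trichotomy {S : Finset (Fin N → Bool)} (hS : S.Nonempty) (hT : TripleClosed S)
    (a : Fin N → Bool) :
    parityBias (unifOn S) a = 0 ∨ parityBias (unifOn S) a = 1 ∨ parityBias (unifOn S) a = -1 := by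
  rw [parityBias_unifOn]
  have hc : (S.card : ℝ) ≠ 0 := by exact_mod_cast hS.card_pos.ne'
  rcases coset_chi_dichotomy hT a with h | h
  · left; rw [h, zero_div]
  · right
    obtain ⟨s₀, hs₀⟩ := hS
    have hsum : ∑ s ∈ S, chi a s = S.card * chi a s₀ := by
      rw [Finset.sum_congr rfl fun s hs => h s hs s₀ hs₀, Finset.sum_const, nsmul_eq_mul]
    rw [hsum, mul_div_cancel_left₀ _ hc]
    unfold chi; split_ifs <;> simp

/-- Odd powers of a bias of `unifOn S` (coset). -/
theorem parityBias_unifOn_pow_odd {S : Finset (Fin N → Bool)} (hS : S.Nonempty) (hT : TripleClosed S)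
    (a : Fin N → Bool) {d : ℕ} (hd : d % 2 = 1) : parityBias (unifOn S) a ^ d = parityBias (unifOn S) a := by
  rcases parityBias_unifOn_trichotomy hS hT a with h | h | h
  · rw [h, zero_pow]; omega
  · rw [h, one_pow]
  · rw [h, (Nat.odd_iff.2 hd).neg_one_pow]

/-! ### The fold law -/

/-- **FOLD LAW** (Sketch10 `L4`): for a nonempty triple-sum-closed `S` and odd `d`, the XOR of `d` independent
samples of `unifOn S ⊕ Ber(p)` has law `unifOn S ⊕ Ber((1 − (1−2p)^d)/2)`. -/
theorem foldLaw {S : Finset (Fin N → Bool)} (hS : S.Nonempty) (hT : TripleClosed S) {d : ℕ} (hd : d % 2 = 1)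
    (p : ℝ) :
    xorFold (List.replicate d (xorConv (unifOn S) (ber N p))) =
      xorConv (unifOn S) (ber N ((1 - (1 - 2 * p) ^ d) / 2)) := by
  refine eq_of_parityBias_eq _ _ fun a => ?_
  rw [parityBias_xorFold_replicate, parityBias_xorConv, parityBias_xorConv, parityBias_ber, parityBias_ber,
    mul_pow, parityBias_unifOn_pow_odd hS hT a hd, ← pow_mul, mul_comm (hw a) d, pow_mul]
  congr 2
  ring

end CubeDistr

end Summit.QuantumAdvantage.AdviceFreeQNC0
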